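import Summits.ResolutionOfSingularities.ResolutionOfSingularities.Theorems.PurelyInseparableDim4E2OfCJSLocalizeProof
import Summits.ResolutionOfSingularities.ResolutionOfSingularities.Theorems.PurelyInseparableDim4StrictTransformBlowupPoint
import Literature.AlgebraicGeometry.Resolution.StalkIdealLemmas
import Literature.AlgebraicGeometry.Resolution.MarkedIdealsLemmas
import HarnessLib
import HarnessLib.Audit.Tags

/-!
# F4-I(3,3) from CJS — row (M) `ModelRow` FROM THE TOWER INVARIANTS (cell `res-dim4-pi`; seat p-7 g2, holder
# res-dim4-p-2 g2, (M-c) theorem res-dim4-p-5 g2, K res-dim4-p-9 g2)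

[OURS · counted 0 · AI work weaker than expert review.]  NOTHING here proves `NoIsolatedTrap 3 3` or resolution of
singularities in dimension ≥ 4 / characteristic `p`.

Sequel of `…E2OfCJSLocalizeProof` (p667552: `localizationRow_of_strictTransform : StrictTransformBlowup →
LocalizationRow`, the localisation built from hypersurface blow-ups).  res-dim4-p-5 g2's (M-c) THEOREM
`StrictTransformBlowup.exists_isBlowup_subscheme_transform_point` (p667059) produces those blow-ups on a REGULAR ambient
with an effective-Cartier marked ideal of order `= mult` at a closed non-open point, with centre
`𝓘_x · 𝒪_{V(M.ideal)} = (vanishingIdeal {x}).comap ι`.  Here: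

* `comap_subschemeι_vanishingIdeal_singleton` — that centre IS the ideal of the closed point of the hypersurface over
  `x` (stalkwise: surjective local stalk map of the closed immersion; `le_of_forall_stalkIdeal_le`);
* `exists_localization_of_blowups` — the localisation construction of p667552 with the per-stage hypersurface blow-ups
  as HYPOTHESIS, in p-5 g2's centre shape;
* `TowerInvariants : Prop` (OURS, hypothesis, not asserted) — along res-dim4-p-2 g2's concrete tower `GStage.tower`:
  ambient regular, marked ideal effective Cartier, order `= mult` at the marked point, marked point not open
  (res-dim4-p-5 g2's induction);
* **`modelRow_of_towerInvariants : TowerInvariants → ModelRow`** (the successor's marked ideal IS the transform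
  definitionally, `GStage.tower_succ_M`), and the assembly
  `noIsolatedTrap_three_three_of_CJS_of_towerInvariants : KeyTheorem640… → TowerInvariants → NearRow → DirectrixRow →
  IsolationRow → NoIsolatedTrap 3 3` (rows N/E/I are tree theorems of p-1 g2 / p-11 g2; X discharged inside).

bears_on: LADDER-RESOLUTION:D157-DOOR2 (res-dim4-pi · F4-I(3,3) · CJS dictionary · row M).  Supports
stmt-ResolutionOfSingularities-16155 (helper).
-/

set_option linter.dupNamespace false -- mandated namespace of this single-conjunct summit

noncomputable section

open CategoryTheory CategoryTheory.Limits AlgebraicGeometry TopologicalSpace IsLocalRing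
open Literature.AlgebraicGeometry.Resolution
open Literature.AlgebraicGeometry.Resolution.Hauser2010
open Literature.AlgebraicGeometry.Resolution.AffinePointBlowup (P A ξ)
open Literature.AlgebraicGeometry.CossartJannsenSaito2020
open Scheme.IdealSheafData
open Summit.ResolutionOfSingularities.ResolutionOfSingularities.Theorems.SigmaMaxModificationsCorridor3.Moving

namespace Summit.ResolutionOfSingularities.ResolutionOfSingularities.Theorems.PIDim4

namespace E2OfCJS

open RidgeBudget (ebar)

/-! ## The construction from per-stage hypersurface blow-ups in res-dim4-p-5 g2's landed shape, and
`ModelRow` from the tower invariants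

res-dim4-p-5 g2's (M-c) THEOREM `StrictTransformBlowup.exists_isBlowup_subscheme_transform_point` (p667059) gives,
on a REGULAR ambient with an effective-Cartier marked ideal of order `= mult` at a closed non-open point, the morphism
`V(M'.ideal) ⟶ V(M.ideal)` as a blow-up along `𝓘_x · 𝒪_{V(M.ideal)} = (vanishingIdeal {x}).comap ι`.  Below:
`comap_subschemeι_vanishingIdeal_singleton` identifies that centre with the ideal of the closed point of the
hypersurface; `exists_localization_of_blowups` is the §2 construction with the per-stage blow-ups as HYPOTHESIS (in that
centre shape); `modelRow_of_towerInvariants` closes row (M) on res-dim4-p-2 g2's concrete tower `GStage.tower` from the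
four tower invariants (ambient regular · marked ideal effective Cartier · order = mult at the marked point · marked point
not open), which res-dim4-p-5 g2 supplies. -/

section FromInvariants

/-- **The centre `𝓘_x · 𝒪_{V(I)}` is the ideal of the closed point `y` of `V(I)` over the closed point `x`**:
`(vanishingIdeal {x}).comap ι = vanishingIdeal {y}` (stalks: both are the maximal ideal at `y` — the stalk map of the
closed immersion is a surjective local homomorphism — and the unit ideal elsewhere; ideal sheaves are determined by their
stalks, `le_of_forall_stalkIdeal_le`). [folklore] -/
theorem comap_subschemeι_vanishingIdeal_singleton {Z : Scheme.{0}} (I : Z.IdealSheafData) {x : Z}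
    (hx : IsClosed ({x} : Set Z)) (y : I.subscheme) (hy : I.subschemeι y = x)
    (hycl : IsClosed ({y} : Set I.subscheme)) :
    (vanishingIdeal ⟨{x}, hx⟩).comap I.subschemeι = vanishingIdeal ⟨{y}, hycl⟩ := by
  subst hy
  apply le_antisymm
  · -- the support of the comap contains `y`
    rw [← Scheme.IdealSheafData.gc.le_iff_le]
    show (⟨{y}, hycl⟩ : Closeds I.subscheme) ≤ ((vanishingIdeal ⟨{I.subschemeι y}, hx⟩).comap I.subschemeι).support
    intro z hz
    rw [Set.mem_singleton_iff.mp hz]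
    show y ∈ (((vanishingIdeal ⟨{I.subschemeι y}, hx⟩).comap I.subschemeι).support : Set I.subscheme)
    rw [support_comap]
    show I.subschemeι y ∈ ((vanishingIdeal (⟨{I.subschemeι y}, hx⟩ : Closeds Z)).support : Set Z)
    rw [Scheme.IdealSheafData.coe_support_vanishingIdeal]
    exact Set.mem_singleton _
  · refine le_of_forall_stalkIdeal_le fun z => ?_
    by_cases hz : z = y
    · subst hz
      rw [stalkIdeal_vanishingIdeal_singleton hycl, stalkIdeal_comap_eq_map_stalkMap,
        stalkIdeal_vanishingIdeal_singleton hx]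
      -- `𝔪_y ≤ 𝔪_x · 𝒪_{V(I),y}` : a surjective stalk map
      intro m hm
      obtain ⟨a, ha⟩ := I.subschemeι.stalkMap_surjective z m
      have hax : a ∈ maximalIdeal (Z.presheaf.stalk (I.subschemeι z)) := by
        rw [mem_maximalIdeal, mem_nonunits_iff]
        intro hu
        rw [mem_maximalIdeal, mem_nonunits_iff] at hm
        exact hm (ha ▸ hu.map _)
      rw [← ha]
      exact Ideal.mem_map_of_mem _ hax
    · -- off `y` the comap is the unit ideal
      have hnot : z ∉ ((vanishingIdeal ⟨{I.subschemeι y}, hx⟩).comap I.subschemeι).support := by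
        intro hmem
        have hmem' : z ∈ ((((vanishingIdeal ⟨{I.subschemeι y}, hx⟩).comap I.subschemeι).support :
            Set I.subscheme)) := hmem
        rw [support_comap] at hmem'
        have h1 : I.subschemeι z ∈ ((vanishingIdeal (⟨{I.subschemeι y}, hx⟩ : Closeds Z)).support : Set Z) :=
          hmem'
        rw [Scheme.IdealSheafData.coe_support_vanishingIdeal] at h1
        exact hz (I.subschemeι.isEmbedding.injective (Set.mem_singleton_iff.mp h1))
      rw [mem_support_iff_stalkIdeal_ne_top, not_not] at hnot
      rw [hnot]
      exact le_top

/-- **THE §2 CONSTRUCTION WITH THE HYPERSURFACE BLOW-UPS AS HYPOTHESIS** (in res-dim4-p-5 g2's centre shape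
`(vanishingIdeal {x i}).comap ι`): local schemes, base-changed blow-ups, closed lifts, links and presentations.
[cite: CossartJannsenSaito2020, p. 107, Def. 6.38 / 6.39] [cite: GortzWedhorn2020, Prop. 13.91 (2)] -/
theorem exists_localization_of_blowups (K : Type) [Field K] (c : ℕ → State K)
    (hord : ∀ k, ordZero (c k).F = (3 : ℕ∞)) (Z : ℕ → Scheme.{0}) (hZ : ∀ i, IsLocallyNoetherian (Z i))
    (M : ∀ i, MarkedIdeal (Z i)) (x : ∀ i, ↥(Z i)) (hx : ∀ i, IsClosed ({x i} : Set (Z i)))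
    (φ : ∀ i, P 4 K ⟶ Z i) (hφoi : ∀ i, IsOpenImmersion (φ i)) (π : ∀ i, Z (i + 1) ⟶ Z i)
    (hφ : ∀ i, (φ i) (ξ 4 K) = x i) (hMφ : ∀ i, (M i).ideal.comap (φ i) = hypSheaf 3 (c i).F)
    (hπx : ∀ i, (π i) (x (i + 1)) = x i)
    (hρ : ∀ i, ∃ ρ : (M (i + 1)).ideal.subscheme ⟶ (M i).ideal.subscheme,
      ρ ≫ (M i).ideal.subschemeι = (M (i + 1)).ideal.subschemeι ≫ π i ∧
        IsBlowup ρ ((vanishingIdeal ⟨{x i}, hx i⟩).comap (M i).ideal.subschemeι)) :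
    ∃ (S B : ℕ → Scheme.{0}) (_ : ∀ i, IsLocallyNoetherian (S i)) (_ : ∀ i, IsLocallyNoetherian (B i))
      (π' : ∀ i, B i ⟶ S i) (pt : ∀ i, ↥(S i)) (b : ∀ i, ↥(B i)) (hcl : ∀ i, IsClosed ({pt i} : Set (S i))),
      (∀ i, IsBlowup (π' i) (vanishingIdeal ⟨{pt i}, hcl i⟩)) ∧ (∀ i, (π' i).base (b i) = pt i) ∧
      (∀ i, IsClosed ({b i} : Set (B i))) ∧ (∀ i, IsLocalSchemeAt (S (i + 1)) (pt (i + 1)) (B i) (b i)) ∧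
      (∀ i, IsLocalAt (S i) (pt i)) ∧
      (∀ i, PresentedBy K (c i).F (S i) (pt i)) ∧ (∀ i, PresentedBy K (c (i + 1)).F (B i) (b i)) := by
  have hxmem : ∀ i, x i ∈ (M i).ideal.support := fun i =>
    mem_support_of_chart (M i) (φ i) (hφ i) (hord i) (hMφ i)
  let xt : ∀ i, ↥((M i).ideal.subscheme) := fun i => ⟨x i, hxmem i⟩
  have hιxt : ∀ i, (M i).ideal.subschemeι (xt i) = x i := fun i => rfl
  have hxtcl : ∀ i, IsClosed ({xt i} : Set ↥((M i).ideal.subscheme)) := fun i =>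
    isClosed_singleton_of_subschemeι _ _ (by rw [hιxt]; exact hx i)
  haveI hXln : ∀ i, IsLocallyNoetherian (M i).ideal.subscheme := fun i =>
    LocallyOfFiniteType.isLocallyNoetherian (M i).ideal.subschemeι
  have hρex : ∀ i, ∃ ρ : (M (i + 1)).ideal.subscheme ⟶ (M i).ideal.subscheme,
      ρ ≫ (M i).ideal.subschemeι = (M (i + 1)).ideal.subschemeι ≫ π i ∧
        IsBlowup ρ (vanishingIdeal ⟨{xt i}, hxtcl i⟩) := by
    intro i
    obtain ⟨ρ, hcomm, hbl⟩ := hρ i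
    refine ⟨ρ, hcomm, ?_⟩
    rw [← comap_subschemeι_vanishingIdeal_singleton (M i).ideal (hx i) (xt i) (hιxt i) (hxtcl i)]
    exact hbl
  choose ρ hρcomm hρbl using hρex
  have hρxt : ∀ i, (ρ i).base (xt (i + 1)) = xt i := by
    intro i
    apply (M i).ideal.subschemeι.isEmbedding.injective
    have h := congrArg (fun f => f.base (xt (i + 1))) (hρcomm i)
    simp only [Scheme.Hom.comp_base, TopCat.coe_comp, Function.comp_apply] at h
    exact h.trans (hπx i)
  have hc0 : ∀ i, (((M i).ideal.subscheme).fromSpecStalk (xt i)).base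
      (closedPoint (((M i).ideal.subscheme).presheaf.stalk (xt i))) = xt i :=
    fun i => Scheme.fromSpecStalk_closedPoint
  have hptcl : ∀ i, IsClosed ({closedPoint (((M i).ideal.subscheme).presheaf.stalk (xt i))} :
      Set ↥(Spec (((M i).ideal.subscheme).presheaf.stalk (xt i)))) :=
    fun i => isClosed_singleton_of_fromSpecStalk_eq (hc0 i)
  haveI hBln : ∀ i, IsLocallyNoetherian
      (pullback (ρ i) (((M i).ideal.subscheme).fromSpecStalk (xt i))) :=
    fun i => isLocallyNoetherian_pullback_fromSpecStalk (hρbl i) (xt i)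
  have hrad : ∀ i, vanishingIdeal (⟨{xt i}, hxtcl i⟩ : Closeds ↥((M i).ideal.subscheme)) =
      vanishingIdeal (vanishingIdeal (⟨{xt i}, hxtcl i⟩ : Closeds ↥((M i).ideal.subscheme))).support := by
    intro i
    rw [show (vanishingIdeal (⟨{xt i}, hxtcl i⟩ : Closeds ↥((M i).ideal.subscheme))).support =
      (⟨{xt i}, hxtcl i⟩ : Closeds ↥((M i).ideal.subscheme)) from
        SetLike.coe_injective (Scheme.IdealSheafData.coe_support_vanishingIdeal _)]
  have hmax : ∀ i, stalkIdeal (vanishingIdeal (⟨{xt i}, hxtcl i⟩ : Closeds ↥((M i).ideal.subscheme))) (xt i) =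
      maximalIdeal _ := fun i => stalkIdeal_vanishingIdeal_singleton (hxtcl i)
  have hbl' : ∀ i, IsBlowup (pullback.snd (ρ i) (((M i).ideal.subscheme).fromSpecStalk (xt i)))
      (vanishingIdeal ⟨{closedPoint (((M i).ideal.subscheme).presheaf.stalk (xt i))}, hptcl i⟩) :=
    fun i => isBlowup_pullback_snd_fromSpecStalk_singleton (hρbl i) (hrad i) (hmax i) (hc0 i)
  have hlift : ∀ i, ∃ b : ↥(pullback (ρ i) (((M i).ideal.subscheme).fromSpecStalk (xt i))),
      (pullback.fst (ρ i) (((M i).ideal.subscheme).fromSpecStalk (xt i))).base b = xt (i + 1) ∧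
        (((M i).ideal.subscheme).fromSpecStalk (xt i)).base
            ((pullback.snd (ρ i) (((M i).ideal.subscheme).fromSpecStalk (xt i))).base b) = xt i ∧
          IsIso ((pullback.fst (ρ i) (((M i).ideal.subscheme).fromSpecStalk (xt i))).stalkMap b) :=
    fun i => exists_lift_pullback_fromSpecStalk (ρ i) (xt i) (hρxt i)
  choose b hb hbs hbiso using hlift
  have hstalk : ∀ i, Nonempty ((pullback (ρ i) (((M i).ideal.subscheme).fromSpecStalk (xt i))).presheaf.stalk
      (b i) ≅ ((M (i + 1)).ideal.subscheme).presheaf.stalk (xt (i + 1))) := by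
    intro i
    haveI := hbiso i
    exact ⟨(asIso ((pullback.fst (ρ i) (((M i).ideal.subscheme).fromSpecStalk (xt i))).stalkMap (b i))).symm ≪≫
      eqToIso (by rw [hb i])⟩
  have hpres : ∀ i, Nonempty (((M i).ideal.subscheme).presheaf.stalk (xt i) ≅ HypStalk K (c i).F) := by
    intro i
    haveI := hφoi i
    exact exists_hypersurfaceStalkIso (M i) (φ i) (hφ i) (c i) (hMφ i) (xt i) (hιxt i)
  refine ⟨fun i => Spec (((M i).ideal.subscheme).presheaf.stalk (xt i)),
    fun i => pullback (ρ i) (((M i).ideal.subscheme).fromSpecStalk (xt i)), fun i => inferInstance, hBln,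
    fun i => pullback.snd (ρ i) (((M i).ideal.subscheme).fromSpecStalk (xt i)),
    fun i => closedPoint (((M i).ideal.subscheme).presheaf.stalk (xt i)), b, hptcl, hbl', ?_, ?_, ?_, ?_, ?_, ?_⟩
  · exact fun i => eq_closedPoint_of_fromSpecStalk_eq (hbs i)
  · intro i
    have hcl : closure ({b i} : Set ↥(pullback (ρ i) (((M i).ideal.subscheme).fromSpecStalk (xt i)))) ⊆
        {b i} := by
      intro b' hb'
      have hbb' : b i ⤳ b' := specializes_iff_mem_closure.mpr hb'
      have h1 : xt (i + 1) ⤳ (pullback.fst (ρ i) (((M i).ideal.subscheme).fromSpecStalk (xt i))).base b' :=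
        hb i ▸ hbb'.map (pullback.fst (ρ i) (((M i).ideal.subscheme).fromSpecStalk (xt i))).continuous
      have h2 : (pullback.fst (ρ i) (((M i).ideal.subscheme).fromSpecStalk (xt i))).base b' = xt (i + 1) :=
        Set.mem_singleton_iff.mp (h1.mem_closed (hxtcl (i + 1)) rfl)
      have hinj : Function.Injective
          (pullback.fst (ρ i) (((M i).ideal.subscheme).fromSpecStalk (xt i))).base :=
        (pullback.fst (ρ i) (((M i).ideal.subscheme).fromSpecStalk (xt i))).isEmbedding.injective
      exact Set.mem_singleton_iff.mpr (hinj (h2.trans (hb i).symm))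
    exact isClosed_of_closure_subset hcl
  · intro i
    obtain ⟨e⟩ := hstalk i
    exact isLocalSchemeAt_Spec_of_iso e
  · exact fun i => isLocalAt_Spec_closedPoint _
  · intro i
    obtain ⟨e⟩ := hpres i
    exact ⟨stalkClosedPointIso (((M i).ideal.subscheme).presheaf.stalk (xt i)) ≪≫ e⟩
  · intro i
    obtain ⟨e₁⟩ := hstalk i
    obtain ⟨e₂⟩ := hpres (i + 1)
    exact ⟨e₁ ≪≫ e₂⟩

/-- **THE TOWER INVARIANTS** consumed by `modelRow_of_towerInvariants` (res-dim4-p-5 g2's induction along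
res-dim4-p-2 g2's `GStage.tower`): every ambient of the tower is regular, every marked ideal an effective Cartier
divisor of order `= mult` at the marked point, and the marked point is not open.  Stated as a parameterless `Prop` only
to keep signatures readable; a HYPOTHESIS below, not asserted.  (OURS — parameterless `Prop`, deliberately untagged;
not asserted.) -/
def TowerInvariants : Prop :=
  ∀ (K : Type) [Field K] [CharP K 3] [IsAlgClosed K] [DecidableEq K] (c : ℕ → State K)
    (hc : ∀ k, Step0 3 (c k) (c (k + 1))), (∀ k, ordZero (c k).F = (3 : ℕ∞)) →
    ∀ i : ℕ, Scheme.IsRegular (GStage.tower c hc i).Z ∧ IsEffectiveCartier (GStage.tower c hc i).M.ideal ∧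
      idealOrder (GStage.tower c hc i).M.ideal (GStage.tower c hc i).x = (GStage.tower c hc i).M.mult ∧
      ¬ IsOpen ({(GStage.tower c hc i).x} : Set (GStage.tower c hc i).Z)

/-- **ROW (M) `ModelRow` FROM THE TOWER INVARIANTS**: on res-dim4-p-2 g2's concrete tower `GStage.tower c hc`,
res-dim4-p-5 g2's (M-c) theorem `StrictTransformBlowup.exists_isBlowup_subscheme_transform_point` supplies the
hypersurface blow-ups stage by stage (the successor's marked ideal IS the transform, definitionally:
`GStage.tower_succ_M`), and `exists_localization_of_blowups` localises them. [OURS · row M of the E2 transfer row]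
[cite: CossartJannsenSaito2020, p. 107, Def. 6.38 / 6.39] [cite: Kollar2007, 3.30.2] -/
theorem modelRow_of_towerInvariants (hinv : TowerInvariants) : ModelRow := by
  intro K _ _ _ _ c hc
  have hstep : ∀ k, Step0 3 (c k) (c (k + 1)) := fun k => (hc k).2.1
  have hord : ∀ k, ordZero (c k).F = (3 : ℕ∞) := fun k => (hc k).2.2.1
  let T := GStage.tower c hstep
  haveI hln : ∀ i, IsLocallyNoetherian (T i).Z := fun i => (T i).ln
  have hI := hinv K c hstep hord
  have hρ : ∀ i, ∃ ρ : ((T (i + 1)).M).ideal.subscheme ⟶ ((T i).M).ideal.subscheme,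
      ρ ≫ ((T i).M).ideal.subschemeι = ((T (i + 1)).M).ideal.subschemeι ≫ GStage.towerπ c hstep i ∧
        IsBlowup ρ ((vanishingIdeal ⟨{(T i).x}, (T i).hx⟩).comap ((T i).M).ideal.subschemeι) := by
    intro i
    obtain ⟨hreg, hcart, hm, hopen⟩ := hI i
    exact Summit.ResolutionOfSingularities.ResolutionOfSingularities.Theorems.PIDim4.StrictTransformBlowup.exists_isBlowup_subscheme_transform_point
      hreg (T i).hx hopen (GStage.isBlowup_towerπ c hstep i) (T i).M hcart hm
  exact exists_localization_of_blowups K c hord (fun i => (T i).Z) (fun i => (T i).ln) (fun i => (T i).M)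
    (fun i => (T i).x) (fun i => (T i).hx) (fun i => (T i).φ) (fun i => (T i).oi)
    (fun i => GStage.towerπ c hstep i) (fun i => (T i).hφ) (fun i => (T i).hM)
    (fun i => GStage.towerπ_x c hstep i) hρ

/-- **F4-I(3,3) from CJS Thm. 6.40 and the tower invariants**: with rows (N), (E), (I), (X), (M-a), (M-c) in the
tree, `NoIsolatedTrap 3 3 ⟸ KeyTheorem640_char_localized_isolated ∧ TowerInvariants`.
[OURS · conditional assembly] [cite: CossartJannsenSaito2020, Thm. 6.40] -/
theorem noIsolatedTrap_three_three_of_CJS_of_towerInvariants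
    (hK640 : KeyTheorem640_char_localized_isolated.{0}) (hinv : TowerInvariants) (hN : NearRow)
    (hE : DirectrixRow) (hI : IsolationRow) : NoIsolatedTrap 3 3 :=
  noIsolatedTrap_three_three_of_CJS_rows hK640 (modelRow_of_towerInvariants hinv) hN hE hI settingRow

end FromInvariants

end E2OfCJS

end Summit.ResolutionOfSingularities.ResolutionOfSingularities.Theorems.PIDim4

end
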